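import Literature.Topology.FourManifolds.InvertedGermExtension

/-!
# The round crease is mean-convex: sanity rung of the PATH stub of line `round-trace-continuity`
(crux `OrigamiFoldExistence`, stmt-SmoothPoincare4-7844; companion of the round model of route
EuclideanOrigami's item `RoundModel`, stmt-SmoothPoincare4-7488)

The skeleton `Cruxes/OrigamiFoldExistence/Lines/round-trace-continuity.lean` measures MEAN-CONVEXITY of
the crease `g|S³` of a collar germ `g : ℝ⁴ → ℝ⁴` towards the side `Dg(u)·u` by the elementary `fderiv`
predicate `CreaseMeanConvexAt g u`:
`∀ w : Fin 3 → ℝ⁴, (∀ i, ⟪w i, u⟫ = 0) → Orthonormal ℝ (fun i => Dg(u) (w i)) →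
  ∑ i, ‖w i‖² < ∑ i, ⟪Dg(u)⁻¹ (D²g(u)[w i, w i]), u⟫`.
Here we certify, in the kernel, the sign convention on which the stubs `stub_meanConvexUnwinding`
(PATH) and `stub_flatContinuity` hinge: for the ROUND MODEL `g = ι` (inversion in the unit sphere,
the crease germ of the round immersed ball, `RoundModel`), at every unit vector `u`,
`Dι(u) = id − 2⟪u,·⟫u` (a reflection, its own inverse), `D²ι(u)[w,w] = −2‖w‖²u` for `w ⊥ u`, so each
summand on the right is `2‖w i‖² = 2` against `‖w i‖² = 1` on the left: `3 < 6`, i.e. the round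
3-sphere has mean curvature `H = 3 > 0` towards the ball `ι({‖x‖ > 1})`.  Consequently the CONSTANT
family `t ↦ ι` is a mean-convex unwinding ending on the unit round sphere (`c = 0`, `r = 1`): the
target predicate `IsMeanConvexUnwinding` of PATH is satisfiable, with the right side convention.
-/

noncomputable section

-- the prescribed namespace `Summit.<P>.<Sub>.…` duplicates `SmoothPoincare4` (P = Sub)
set_option linter.dupNamespace false

open scoped Topology RealInnerProductSpace ContDiff
open Set Function Literature.Topology.FourManifolds

namespace Summit.SmoothPoincare4.SmoothPoincare4.Theorems.RoundModel

/-! Throughout, the derivative of the inversion `ι z = z/‖z‖²` at `x ≠ 0` is written as the explicit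
continuous linear map `dι(x) := (‖x‖²)⁻¹ • id − (2 (‖x‖²)⁻²) • ⟪x, ·⟫ x` (no auxiliary definition is
introduced, so that this file is a pure proof file). -/

/-- Evaluating the explicit derivative map `dι(x)` of the inversion on a vector. [folklore] -/
theorem dInv_apply (x h : EuclideanSpace ℝ (Fin 4)) :
    ((‖x‖ ^ 2)⁻¹ • ContinuousLinearMap.id ℝ (EuclideanSpace ℝ (Fin 4)) - (2 * ((‖x‖ ^ 2) ^ 2)⁻¹) • (innerSL ℝ x).smulRight x) h = (‖x‖ ^ 2)⁻¹ • h - (2 * ((‖x‖ ^ 2) ^ 2)⁻¹ * ⟪x, h⟫) • x := by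
  simp only [FunLike.coe_sub, FunLike.coe_smul, Pi.sub_apply,
    Pi.smul_apply, ContinuousLinearMap.id_apply, ContinuousLinearMap.smulRight_apply, innerSL_apply_apply,
    smul_smul]

/-- `ι` has derivative `((‖x‖ ^ 2)⁻¹ • ContinuousLinearMap.id ℝ (EuclideanSpace ℝ (Fin 4)) - (2 * ((‖x‖ ^ 2) ^ 2)⁻¹) • (innerSL ℝ x).smulRight x)` at every `x ≠ 0`. [folklore] -/
theorem hasFDerivAt_sphereInversion {x : EuclideanSpace ℝ (Fin 4)} (hx : x ≠ 0) :
    HasFDerivAt (sphereInversion (F := EuclideanSpace ℝ (Fin 4))) (((‖x‖ ^ 2)⁻¹ • ContinuousLinearMap.id ℝ (EuclideanSpace ℝ (Fin 4)) - (2 * ((‖x‖ ^ 2) ^ 2)⁻¹) • (innerSL ℝ x).smulRight x)) x := by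
  have hx2 : ‖x‖ ^ 2 ≠ 0 := pow_ne_zero 2 (norm_ne_zero_iff.mpr hx)
  have hn : HasFDerivAt (fun z : EuclideanSpace ℝ (Fin 4) => ‖z‖ ^ 2) ((2 : ℝ) • innerSL ℝ x) x :=
    (hasStrictFDerivAt_norm_sq x).hasFDerivAt.congr_fderiv
      (by rw [← Nat.cast_smul_eq_nsmul ℝ, Nat.cast_ofNat])
  have hc : HasFDerivAt (fun z : EuclideanSpace ℝ (Fin 4) => (‖z‖ ^ 2)⁻¹)
      ((-((‖x‖ ^ 2) ^ 2)⁻¹) • ((2 : ℝ) • innerSL ℝ x)) x :=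
    (hasDerivAt_inv hx2).comp_hasFDerivAt x hn
  have h := hc.smul (hasFDerivAt_id (𝕜 := ℝ) x)
  have h' : HasFDerivAt (sphereInversion (F := EuclideanSpace ℝ (Fin 4)))
      ((‖x‖ ^ 2)⁻¹ • ContinuousLinearMap.id ℝ (EuclideanSpace ℝ (Fin 4)) +
        ((-((‖x‖ ^ 2) ^ 2)⁻¹) • ((2 : ℝ) • innerSL ℝ x)).smulRight (id x)) x :=
    h.congr_of_eventuallyEq (Filter.Eventually.of_forall fun z => rfl)
  refine h'.congr_fderiv ?_
  ext1 k
  simp only [dInv_apply, FunLike.coe_add, FunLike.coe_smul, Pi.add_apply,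
    Pi.smul_apply, ContinuousLinearMap.id_apply, ContinuousLinearMap.smulRight_apply, innerSL_apply_apply,
    smul_eq_mul, id]
  module

/-- `fderiv ℝ ι x = ((‖x‖ ^ 2)⁻¹ • ContinuousLinearMap.id ℝ (EuclideanSpace ℝ (Fin 4)) - (2 * ((‖x‖ ^ 2) ^ 2)⁻¹) • (innerSL ℝ x).smulRight x)` for `x ≠ 0`. [folklore] -/
theorem fderiv_sphereInversion {x : EuclideanSpace ℝ (Fin 4)} (hx : x ≠ 0) :
    fderiv ℝ (sphereInversion (F := EuclideanSpace ℝ (Fin 4))) x = ((‖x‖ ^ 2)⁻¹ • ContinuousLinearMap.id ℝ (EuclideanSpace ℝ (Fin 4)) - (2 * ((‖x‖ ^ 2) ^ 2)⁻¹) • (innerSL ℝ x).smulRight x) :=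
  (hasFDerivAt_sphereInversion hx).fderiv

/-- At a unit vector the derivative of `ι` is the reflection `h ↦ h − 2⟪u, h⟫u`. [folklore] -/
theorem dInv_apply_of_norm_eq_one {u : EuclideanSpace ℝ (Fin 4)} (hu : ‖u‖ = 1)
    (h : EuclideanSpace ℝ (Fin 4)) : ((‖u‖ ^ 2)⁻¹ • ContinuousLinearMap.id ℝ (EuclideanSpace ℝ (Fin 4)) - (2 * ((‖u‖ ^ 2) ^ 2)⁻¹) • (innerSL ℝ u).smulRight u) h = h - (2 * ⟪u, h⟫) • u := by
  rw [dInv_apply, hu]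
  simp

/-- The reflection `((‖u‖ ^ 2)⁻¹ • ContinuousLinearMap.id ℝ (EuclideanSpace ℝ (Fin 4)) - (2 * ((‖u‖ ^ 2) ^ 2)⁻¹) • (innerSL ℝ u).smulRight u)` (for `‖u‖ = 1`) is an involution. [folklore] -/
theorem dInv_dInv_of_norm_eq_one {u : EuclideanSpace ℝ (Fin 4)} (hu : ‖u‖ = 1)
    (h : EuclideanSpace ℝ (Fin 4)) : ((‖u‖ ^ 2)⁻¹ • ContinuousLinearMap.id ℝ (EuclideanSpace ℝ (Fin 4)) - (2 * ((‖u‖ ^ 2) ^ 2)⁻¹) • (innerSL ℝ u).smulRight u) (((‖u‖ ^ 2)⁻¹ • ContinuousLinearMap.id ℝ (EuclideanSpace ℝ (Fin 4)) - (2 * ((‖u‖ ^ 2) ^ 2)⁻¹) • (innerSL ℝ u).smulRight u) h) = h := by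
  have huu : ⟪u, u⟫ = 1 := by
    rw [real_inner_self_eq_norm_sq, hu]; norm_num
  rw [dInv_apply_of_norm_eq_one hu, dInv_apply_of_norm_eq_one hu, inner_sub_right, inner_smul_right,
    huu]
  module

/-- The generalised inverse of `((‖u‖ ^ 2)⁻¹ • ContinuousLinearMap.id ℝ (EuclideanSpace ℝ (Fin 4)) - (2 * ((‖u‖ ^ 2) ^ 2)⁻¹) • (innerSL ℝ u).smulRight u)` is `((‖u‖ ^ 2)⁻¹ • ContinuousLinearMap.id ℝ (EuclideanSpace ℝ (Fin 4)) - (2 * ((‖u‖ ^ 2) ^ 2)⁻¹) • (innerSL ℝ u).smulRight u)` itself (for `‖u‖ = 1`). [folklore] -/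
theorem inverse_dInv_of_norm_eq_one {u : EuclideanSpace ℝ (Fin 4)} (hu : ‖u‖ = 1) :
    (((‖u‖ ^ 2)⁻¹ • ContinuousLinearMap.id ℝ (EuclideanSpace ℝ (Fin 4)) - (2 * ((‖u‖ ^ 2) ^ 2)⁻¹) • (innerSL ℝ u).smulRight u)).inverse = ((‖u‖ ^ 2)⁻¹ • ContinuousLinearMap.id ℝ (EuclideanSpace ℝ (Fin 4)) - (2 * ((‖u‖ ^ 2) ^ 2)⁻¹) • (innerSL ℝ u).smulRight u) := by
  set L := ((‖u‖ ^ 2)⁻¹ • ContinuousLinearMap.id ℝ (EuclideanSpace ℝ (Fin 4)) - (2 * ((‖u‖ ^ 2) ^ 2)⁻¹) • (innerSL ℝ u).smulRight u) with hL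
  let e : EuclideanSpace ℝ (Fin 4) ≃L[ℝ] EuclideanSpace ℝ (Fin 4) :=
    ContinuousLinearEquiv.equivOfInverse L L (dInv_dInv_of_norm_eq_one hu) (dInv_dInv_of_norm_eq_one hu)
  have hco : ((e : EuclideanSpace ℝ (Fin 4) ≃L[ℝ] EuclideanSpace ℝ (Fin 4)) :
      EuclideanSpace ℝ (Fin 4) →L[ℝ] EuclideanSpace ℝ (Fin 4)) = L := by
    ext1 h; rfl
  rw [← hco, ContinuousLinearMap.inverse_equiv]
  ext1 h; rfl

/-- `((‖u‖ ^ 2)⁻¹ • ContinuousLinearMap.id ℝ (EuclideanSpace ℝ (Fin 4)) - (2 * ((‖u‖ ^ 2) ^ 2)⁻¹) • (innerSL ℝ u).smulRight u)` is bijective (for `‖u‖ = 1`). [folklore] -/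
theorem bijective_dInv_of_norm_eq_one {u : EuclideanSpace ℝ (Fin 4)} (hu : ‖u‖ = 1) :
    Function.Bijective (((‖u‖ ^ 2)⁻¹ • ContinuousLinearMap.id ℝ (EuclideanSpace ℝ (Fin 4)) - (2 * ((‖u‖ ^ 2) ^ 2)⁻¹) • (innerSL ℝ u).smulRight u)) :=
  (ContinuousLinearEquiv.equivOfInverse (((‖u‖ ^ 2)⁻¹ • ContinuousLinearMap.id ℝ (EuclideanSpace ℝ (Fin 4)) - (2 * ((‖u‖ ^ 2) ^ 2)⁻¹) • (innerSL ℝ u).smulRight u)) (((‖u‖ ^ 2)⁻¹ • ContinuousLinearMap.id ℝ (EuclideanSpace ℝ (Fin 4)) - (2 * ((‖u‖ ^ 2) ^ 2)⁻¹) • (innerSL ℝ u).smulRight u)) (dInv_dInv_of_norm_eq_one hu)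
    (dInv_dInv_of_norm_eq_one hu)).bijective

/-- The SECOND derivative of `ι` at a unit vector `u` in a tangent direction `w ⊥ u`, paired with
`w`: `D²ι(u)[w, w] = −2‖w‖² u`.  Stated through `fderiv` of `x ↦ fderiv ℝ ι x w` exactly as in the
skeleton's `CreaseMeanConvexAt`. [folklore] -/
theorem fderiv_fderiv_sphereInversion_apply {u w : EuclideanSpace ℝ (Fin 4)} (hu : ‖u‖ = 1)
    (hw : ⟪w, u⟫ = 0) :
    fderiv ℝ (fun x => fderiv ℝ (sphereInversion (F := EuclideanSpace ℝ (Fin 4))) x w) u w =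
      -((2 * ‖w‖ ^ 2) • u) := by
  have hu0 : u ≠ 0 := by
    intro h; rw [h, norm_zero] at hu; exact zero_ne_one hu
  have huw : ⟪u, w⟫ = 0 := by rw [real_inner_comm]; exact hw
  have hww : ⟪w, w⟫ = ‖w‖ ^ 2 := real_inner_self_eq_norm_sq w
  -- near `u` the inner function is `φ x = ((‖x‖ ^ 2)⁻¹ • ContinuousLinearMap.id ℝ (EuclideanSpace ℝ (Fin 4)) - (2 * ((‖x‖ ^ 2) ^ 2)⁻¹) • (innerSL ℝ x).smulRight x) w`
  have hev : (fun x => fderiv ℝ (sphereInversion (F := EuclideanSpace ℝ (Fin 4))) x w) =ᶠ[𝓝 u]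
      fun x => (‖x‖ ^ 2)⁻¹ • w - (2 * ((‖x‖ ^ 2) ^ 2)⁻¹ * ⟪x, w⟫) • x := by
    filter_upwards [isOpen_ne.mem_nhds hu0] with x hx
    rw [fderiv_sphereInversion hx, dInv_apply]
  rw [hev.fderiv_eq]
  -- differentiate `φ` at `u` by the product rules
  have hn : ∀ y : EuclideanSpace ℝ (Fin 4),
      HasFDerivAt (fun z : EuclideanSpace ℝ (Fin 4) => ‖z‖ ^ 2) ((2 : ℝ) • innerSL ℝ y) y := fun y =>
    (hasStrictFDerivAt_norm_sq y).hasFDerivAt.congr_fderiv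
      (by rw [← Nat.cast_smul_eq_nsmul ℝ, Nat.cast_ofNat])
  have hu2 : ‖u‖ ^ 2 ≠ 0 := by rw [hu]; norm_num
  have hu4 : (‖u‖ ^ 2) ^ 2 ≠ 0 := pow_ne_zero 2 hu2
  -- `a z = (‖z‖²)⁻¹`
  have ha : HasFDerivAt (fun z : EuclideanSpace ℝ (Fin 4) => (‖z‖ ^ 2)⁻¹)
      ((-((‖u‖ ^ 2) ^ 2)⁻¹) • ((2 : ℝ) • innerSL ℝ u)) u :=
    (hasDerivAt_inv hu2).comp_hasFDerivAt u (hn u)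
  -- `d z = ((‖z‖²)²)⁻¹`
  have hsq : HasFDerivAt (fun z : EuclideanSpace ℝ (Fin 4) => (‖z‖ ^ 2) ^ 2)
      ((2 * ‖u‖ ^ 2) • ((2 : ℝ) • innerSL ℝ u)) u := by
    have := (hn u).pow 2
    simpa using this
  have hd : HasFDerivAt (fun z : EuclideanSpace ℝ (Fin 4) => ((‖z‖ ^ 2) ^ 2)⁻¹)
      ((-(((‖u‖ ^ 2) ^ 2) ^ 2)⁻¹) • ((2 * ‖u‖ ^ 2) • ((2 : ℝ) • innerSL ℝ u))) u :=
    (hasDerivAt_inv hu4).comp_hasFDerivAt u hsq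
  -- `i z = ⟪z, w⟫`
  have hi : HasFDerivAt (fun z : EuclideanSpace ℝ (Fin 4) => ⟪z, w⟫) (innerSL ℝ w) u := by
    have : (fun z : EuclideanSpace ℝ (Fin 4) => ⟪z, w⟫) = fun z => innerSL ℝ w z := by
      funext z; rw [innerSL_apply_apply, real_inner_comm]
    rw [this]
    exact (innerSL ℝ w).hasFDerivAt
  -- `s z = 2 * d z * i z`
  have hs : HasFDerivAt (fun z : EuclideanSpace ℝ (Fin 4) => 2 * ((‖z‖ ^ 2) ^ 2)⁻¹ * ⟪z, w⟫)
      ((2 * ((‖u‖ ^ 2) ^ 2)⁻¹) • innerSL ℝ w +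
        ⟪u, w⟫ • ((2 : ℝ) • ((-(((‖u‖ ^ 2) ^ 2) ^ 2)⁻¹) • ((2 * ‖u‖ ^ 2) • ((2 : ℝ) • innerSL ℝ u))))) u := by
    have h2d : HasFDerivAt (fun z : EuclideanSpace ℝ (Fin 4) => 2 * ((‖z‖ ^ 2) ^ 2)⁻¹)
        ((2 : ℝ) • ((-(((‖u‖ ^ 2) ^ 2) ^ 2)⁻¹) • ((2 * ‖u‖ ^ 2) • ((2 : ℝ) • innerSL ℝ u)))) u :=
      hd.const_mul 2
    exact (h2d.mul hi).congr_of_eventuallyEq (Filter.Eventually.of_forall fun z => rfl)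
  have hφ := (ha.smul_const w).sub (hs.smul (hasFDerivAt_id (𝕜 := ℝ) u))
  have hφ' : HasFDerivAt
      (fun x : EuclideanSpace ℝ (Fin 4) => (‖x‖ ^ 2)⁻¹ • w - (2 * ((‖x‖ ^ 2) ^ 2)⁻¹ * ⟪x, w⟫) • x) _ u :=
    hφ.congr_of_eventuallyEq (Filter.Eventually.of_forall fun z => rfl)
  rw [hφ'.fderiv]
  simp only [FunLike.coe_sub, FunLike.coe_add, FunLike.coe_smul,
    Pi.sub_apply, Pi.add_apply, Pi.smul_apply, ContinuousLinearMap.smulRight_apply,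
    ContinuousLinearMap.id_apply, innerSL_apply_apply, smul_eq_mul, hu, huw, hww, id]
  module

/-- **The round crease is mean-convex** (sanity rung of PATH): for the inversion `ι` and every unit
vector `u`, the skeleton's `CreaseMeanConvexAt ι u` holds — written out: for every tangent frame
`w ⊥ u` whose image under `Dι(u)` is orthonormal, `∑ ‖w i‖² < ∑ ⟪Dι(u)⁻¹ (D²ι(u)[w i, w i]), u⟫`
(indeed `3 < 6`: the unit round 3-sphere has mean curvature `3` towards the ball
`ι({‖x‖ > 1})`). [folklore] -/
theorem creaseMeanConvexAt_sphereInversion (u : EuclideanSpace ℝ (Fin 4)) (hu : ‖u‖ = 1) :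
    ∀ w : Fin 3 → EuclideanSpace ℝ (Fin 4), (∀ i, ⟪w i, u⟫ = 0) →
      Orthonormal ℝ (fun i => fderiv ℝ (sphereInversion (F := EuclideanSpace ℝ (Fin 4))) u (w i)) →
        ∑ i, ‖w i‖ ^ 2 <
          ∑ i, ⟪(fderiv ℝ (sphereInversion (F := EuclideanSpace ℝ (Fin 4))) u).inverse
            (fderiv ℝ (fun x => fderiv ℝ (sphereInversion (F := EuclideanSpace ℝ (Fin 4))) x (w i)) u
              (w i)), u⟫ := by
  intro w hwu hon
  have hu0 : u ≠ 0 := by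
    intro h; rw [h, norm_zero] at hu; exact zero_ne_one hu
  have huu : ⟪u, u⟫ = 1 := by
    rw [real_inner_self_eq_norm_sq, hu]; norm_num
  have hDw : ∀ i, ((‖u‖ ^ 2)⁻¹ • ContinuousLinearMap.id ℝ (EuclideanSpace ℝ (Fin 4)) - (2 * ((‖u‖ ^ 2) ^ 2)⁻¹) • (innerSL ℝ u).smulRight u) (w i) = w i := by
    intro i
    rw [dInv_apply_of_norm_eq_one hu, real_inner_comm, hwu i]
    simp
  -- the frame `w` itself is orthonormal, so `‖w i‖ = 1`
  have hnorm : ∀ i, ‖w i‖ = 1 := by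
    intro i
    have := hon.1 i
    simpa [fderiv_sphereInversion hu0, hDw i] using this
  -- evaluate the right-hand summands: each equals `2 ‖w i‖²`
  have hR : ∀ i, ⟪(fderiv ℝ (sphereInversion (F := EuclideanSpace ℝ (Fin 4))) u).inverse
      (fderiv ℝ (fun x => fderiv ℝ (sphereInversion (F := EuclideanSpace ℝ (Fin 4))) x (w i)) u (w i)),
        u⟫ = 2 * ‖w i‖ ^ 2 := by
    intro i
    rw [fderiv_fderiv_sphereInversion_apply hu (hwu i), fderiv_sphereInversion hu0,
      inverse_dInv_of_norm_eq_one hu, map_neg, map_smul, dInv_apply_of_norm_eq_one hu, huu]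
    rw [inner_neg_left, inner_smul_left, inner_sub_left, inner_smul_left, huu]
    simp
    ring
  simp only [hR, hnorm]
  norm_num

/-- **The constant unwinding at the round model is a mean-convex unwinding** ending on the unit
round sphere: the family `g t = ι` (all `t`) satisfies the skeleton's `IsMeanConvexUnwinding g 0 1`
— written out: joint smoothness of `(t, u) ↦ ι u` at `[0,1] × S³`, bijectivity of `Dι(u)`,
mean-convexity of the crease at every unit `u`, and `dist (ι u) 0 = 1`.  Non-vacuity (with the
correct side convention) of the target predicate of PATH (`stub_meanConvexUnwinding`). [folklore] -/
theorem isMeanConvexUnwinding_const_sphereInversion :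
    (∀ t ∈ Icc (0 : ℝ) 1, ∀ u : EuclideanSpace ℝ (Fin 4), ‖u‖ = 1 →
      ContDiffAt ℝ ∞ (Function.uncurry fun (_ : ℝ) (x : EuclideanSpace ℝ (Fin 4)) =>
          sphereInversion (F := EuclideanSpace ℝ (Fin 4)) x) (t, u) ∧
        Function.Bijective (fderiv ℝ (sphereInversion (F := EuclideanSpace ℝ (Fin 4))) u) ∧
        (∀ w : Fin 3 → EuclideanSpace ℝ (Fin 4), (∀ i, ⟪w i, u⟫ = 0) →
          Orthonormal ℝ (fun i => fderiv ℝ (sphereInversion (F := EuclideanSpace ℝ (Fin 4))) u (w i)) →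
            ∑ i, ‖w i‖ ^ 2 <
              ∑ i, ⟪(fderiv ℝ (sphereInversion (F := EuclideanSpace ℝ (Fin 4))) u).inverse
                (fderiv ℝ (fun x => fderiv ℝ (sphereInversion (F := EuclideanSpace ℝ (Fin 4))) x (w i)) u
                  (w i)), u⟫)) ∧
      ∀ u : EuclideanSpace ℝ (Fin 4), ‖u‖ = 1 →
        dist (sphereInversion (F := EuclideanSpace ℝ (Fin 4)) u) 0 = 1 := by
  refine ⟨fun t _ u hu => ⟨?_, ?_, creaseMeanConvexAt_sphereInversion u hu⟩, fun u hu => ?_⟩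
  · have hu0 : u ≠ 0 := by
      intro h; rw [h, norm_zero] at hu; exact zero_ne_one hu
    have hι : ContDiffAt ℝ ∞ (sphereInversion (F := EuclideanSpace ℝ (Fin 4))) u :=
      (sphereInversion.contDiffOn.contDiffWithinAt (by simpa using hu0)).contDiffAt
        (isOpen_ne.mem_nhds hu0)
    exact hι.comp (t, u) contDiffAt_snd
  · have hu0 : u ≠ 0 := by
      intro h; rw [h, norm_zero] at hu; exact zero_ne_one hu
    rw [fderiv_sphereInversion hu0]
    exact bijective_dInv_of_norm_eq_one hu
  · rw [dist_zero_right, sphereInversion.apply_def, norm_smul, hu]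
    simp

end Summit.SmoothPoincare4.SmoothPoincare4.Theorems.RoundModel

end
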